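import Literature.Algebra.Lie.HyperbolicPlaneJordanLefschetzPairReal
import Literature.Algebra.Lie.LefschetzTripleTransport
import HarnessLib

/-!
# The matrix models: `𝔰𝔬(J)` (`J` real symmetric invertible with a hyperbolic pair) and Mathlib's `𝔰𝔬(p, q) = so' p q ℝ` (`p, q ≥ 1`, `p + q ≥ 3`) carry Jordan–Lefschetz gradings

Topic `Literature/Algebra/Lie` (namespace `Literature.Algebra.Lie.HyperbolicPlaneGrading`, continued).  Lane `lit-hodgefound`
(Track 2 foundations library), skeleton seat `lit-hodgefound-skel-1` (generation 52), row **A1-218** of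
`run/shared/lean/pub/lit-hodgefound/SKELETON.md`; the matrix corollaries of row A1-216
(`isJordanLefschetzPair_hyperbolicGrading_real`: a hyperbolic pair in a real quadratic space of dimension `≥ 3` grades
`𝔰𝔬(V, B)` into a Jordan–Lefschetz pair), in the style of row A1-215 (`RealOrthogonalMatrixAlgebraSemisimple`):

* **`exists_isJordanLefschetzPair_skewAdjointMatrices`**: for a real symmetric `J` with `det J ≠ 0`, `|n| ≥ 3` and a
  hyperbolic pair `e, f ∈ ℝⁿ` for `B_J(v, w) = vᵀJw`, the matrix of `h_{e,f}` lies in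
  `skewAdjointMatricesLieSubalgebra J` and makes it a Jordan–Lefschetz pair — transported from row A1-216 along
  Mathlib's `lieEquivMatrix'` (`T ↦` its matrix) restricted to `𝔰𝔬(ℝⁿ, B_J) ≃ 𝔰𝔬(J)` (`LieEquiv.ofSubalgebras`) by
  the tree's `IsJordanLefschetzPair.map`;
* **`exists_isJordanLefschetzPair_so'`: Mathlib's indefinite orthogonal Lie algebra `LieAlgebra.Orthogonal.so' p q ℝ`
  (`J = diag(1_p, -1_q)`) carries a Jordan–Lefschetz grading whenever `p, q ≥ 1` and `p + q ≥ 3`** — the hyperbolic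
  pair `e = ε_a + ε_b`, `f = ½(ε_a - ε_b)` (`a ∈ p`, `b ∈ q`); `exists_isLefschetzPair_so'`.  These are the real forms
  Looijenga–Lunts meet: `𝔰𝔬(4, b_2(X) − 2)` ((4.5), hyperkähler), `𝔰𝔬(3, 19) ⊂ 𝔰𝔬(4, 20)` (K3), the total Lie algebras of
  compact Kähler manifolds — as abstract Lie algebras with a Jordan–Lefschetz grading.

THEOREMS ONLY (no definition, no named fact, no `sorry`; net debt `0`); the Lie structures of the ambient `End(ℝⁿ)` and
`M_n(ℝ)` (needed to speak of `lieEquivMatrix'`) are supplied by `letI` inside the proof, as in row A1-215.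

## Source, VERBATIM

E. Looijenga, V. A. Lunts, *A Lie algebra attached to a projective variety*, Invent. Math. **129** (1997) 361–412 (held
TeX `paper:arxiv-alg-geom_9604014`), §2 (2.9) p. 10 L94–L103 ("Case `(B_m, B_{m-1})` or `(D_m, D_{m-1})`:
`(𝔰𝔬(n), 𝔰𝔬(n-2))` […] Choose isotropic lines `V_{±2}` such that `V_{-2} ⊕ V_2` is nondegenerate […] let `h ∈ 𝔰𝔬(V)`
be the element with the eigen space decomposition `V_{-2} ⊕ V_0 ⊕ V_2`"); §4 (4.5) p. 19 L23–L26: "(i) The pair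
`(𝔤_tot(X;ℝ), h)` is of Jordan–Lefschetz type of type `(B,B)` or `(D,D)` with `𝔤_tot(X;ℝ)` isomorphic to
`𝔰𝔬(4, b_2(X)−2)`."  B. C. Hall, *Lie Groups, Lie Algebras, and Representations*, 2nd ed., GTM 222 (2015), §3.4
Proposition 3.25 p0062 L22–L34 (`so(n;k)`: "`gXᵗʳg = −X`", Mathlib's `so'`).

## Contents (all proved)

* **`exists_isJordanLefschetzPair_skewAdjointMatrices`**, **`exists_isJordanLefschetzPair_so'`**, `exists_isLefschetzPair_so'`.

## SCOPE (what is NOT formalised here)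

(a) The compact form `so n ℝ` (`J = 1`) has no isotropic vectors and carries no such grading — nothing is claimed
about it.  (b) Which `(p, q)` occur geometrically is prover seat p06's topic.

## References

* [LooijengaLunts1997] E. Looijenga, V. A. Lunts, *A Lie algebra attached to a projective variety*, Invent. Math. 129
  (1997) 361–412; arXiv:alg-geom/9604014. §2 (2.9) p. 10; §4 (4.5) p. 19.
* [Hall2015] B. C. Hall, *Lie Groups, Lie Algebras, and Representations*, 2nd ed., Springer GTM 222 (2015), §3.4
  Proposition 3.25.
-/

namespace Literature.Algebra.Lie.HyperbolicPlaneGrading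

open Module Function Literature.Algebra.Lie LieAlgebra.Orthogonal

/-- **Matrix model: `(𝔰𝔬(J), h_{e,f})` is a Jordan–Lefschetz pair over `ℝ`** for every real symmetric `J` with
`det J ≠ 0`, `|n| ≥ 3` and a hyperbolic pair `e, f ∈ ℝⁿ` for `B_J(v, w) = vᵀJw` — transported from row A1-216's
`isJordanLefschetzPair_hyperbolicGrading_real` along Mathlib's `lieEquivMatrix'` (`T ↦` its matrix), which carries
`𝔰𝔬(ℝⁿ, B_J)` onto `skewAdjointMatricesLieSubalgebra J` (as in row A1-215).
[cite: LooijengaLunts1997, §2 (2.9) p. 10 L94–L103; §4 (4.5) p. 19 L23–L26 ("𝔰𝔬(4, b_2(X)−2)")] -/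
theorem exists_isJordanLefschetzPair_skewAdjointMatrices {n : Type*} [Fintype n] [DecidableEq n] (J : Matrix n n ℝ)
    (hJ : J.IsSymm) (hdet : J.det ≠ 0) (h3 : 3 ≤ Fintype.card n) {e f : n → ℝ}
    (he : Matrix.toLinearMap₂' ℝ J e e = 0) (hf : Matrix.toLinearMap₂' ℝ J f f = 0)
    (hef : Matrix.toLinearMap₂' ℝ J e f = 1) :
    ∃ H : skewAdjointMatricesLieSubalgebra J,
      (H : Matrix n n ℝ) = LinearMap.toMatrix' ((2 : ℝ) • (((Matrix.toLinearMap₂' ℝ J).flip f).smulRight e -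
        ((Matrix.toLinearMap₂' ℝ J).flip e).smulRight f)) ∧ IsJordanLefschetzPair ℝ H := by
  set B : LinearMap.BilinForm ℝ (n → ℝ) := Matrix.toLinearMap₂' ℝ J with hBdef
  have hs' : B.IsSymm := Matrix.isSymm_toBilin'_iff_isSymm.2 hJ
  have hs : ∀ u v, B u v = B v u := LinearMap.BilinForm.isSymm_def.1 hs'
  have hB : B.Nondegenerate := LinearMap.BilinForm.nondegenerate_toBilin'_of_det_ne_zero' J hdet
  have h3' : 3 ≤ finrank ℝ (n → ℝ) := by rwa [Module.finrank_fintype_fun_eq_card]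
  have JL := isJordanLefschetzPair_hyperbolicGrading_real hB hs he hf hef h3'
    ⟨_, hyperbolicGrading_mem_skewAdjointLieSubalgebra hs e f⟩ rfl
  -- membership bridge: `toLin' A` is `B`-skew-adjoint iff `A` is `J`-skew-adjoint
  have key : ∀ A : Matrix n n ℝ, Matrix.toLin' A ∈ skewAdjointLieSubalgebra B ↔ A ∈ skewAdjointMatricesLieSubalgebra J :=
    fun A ↦ by
    rw [Literature.LinearAlgebra.Alternating.mem_skewAdjointLieSubalgebra_iff, mem_skewAdjointMatricesLieSubalgebra, mem_skewAdjointMatricesSubmodule,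
      Matrix.IsSkewAdjoint, ← isAdjointPair_toLinearMap₂']
    simp only [LinearMap.IsAdjointPair, map_neg, LinearMap.neg_apply, hBdef]
  letI : LieRing (Module.End ℝ (n → ℝ)) := LieRing.ofAssociativeRing
  letI : LieAlgebra ℝ (Module.End ℝ (n → ℝ)) := LieAlgebra.ofAssociativeAlgebra
  letI : LieRing (Matrix n n ℝ) := LieRing.ofAssociativeRing
  letI : LieAlgebra ℝ (Matrix n n ℝ) := LieAlgebra.ofAssociativeAlgebra
  have hmap : (skewAdjointLieSubalgebra B).map (lieEquivMatrix' (R := ℝ) (n := n)).toLieHom =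
      skewAdjointMatricesLieSubalgebra J := by
    refine LieSubalgebra.ext _ _ fun A ↦ ?_
    rw [LieSubalgebra.mem_map]
    constructor
    · rintro ⟨g, hg, rfl⟩
      have h := (key (LinearMap.toMatrix' g)).1 (by rwa [Matrix.toLin'_toMatrix'])
      rwa [LieEquiv.coe_toLieHom, lieEquivMatrix'_apply]
    · intro hA
      exact ⟨Matrix.toLin' A, (key A).2 hA, by rw [LieEquiv.coe_toLieHom, lieEquivMatrix'_apply, LinearMap.toMatrix'_toLin']⟩
  let E := LieEquiv.ofSubalgebras _ _ (lieEquivMatrix' (R := ℝ) (n := n)) hmap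
  exact ⟨E _, by rw [LieEquiv.ofSubalgebras_apply, lieEquivMatrix'_apply]; rfl, JL.map E⟩

/-- **`𝔰𝔬(p, q)` carries a Jordan–Lefschetz grading for all `p, q ≥ 1` with `p + q ≥ 3`** (Mathlib's
`LieAlgebra.Orthogonal.so' p q ℝ`, `J = diag(1_p, -1_q)`): the hyperbolic pair `e = ε_a + ε_b`,
`f = ½(ε_a - ε_b)` (`a ∈ p`, `b ∈ q`) — e.g. Looijenga–Lunts' `𝔰𝔬(4, b_2(X) − 2)` and `𝔰𝔬(3, 19) ⊂ 𝔰𝔬(4, 20)` for K3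
surfaces. [cite: LooijengaLunts1997, §2 (2.9) p. 10 L94–L103; §4 (4.5) p. 19 L23–L26, L83, L101] -/
theorem exists_isJordanLefschetzPair_so' (p q : Type*) [Fintype p] [DecidableEq p] [Fintype q] [DecidableEq q]
    [Nonempty p] [Nonempty q] (h3 : 3 ≤ Fintype.card p + Fintype.card q) :
    ∃ H : so' p q ℝ, IsJordanLefschetzPair ℝ H := by
  obtain ⟨a⟩ := ‹Nonempty p›
  obtain ⟨b⟩ := ‹Nonempty q›
  set J : Matrix (p ⊕ q) (p ⊕ q) ℝ := indefiniteDiagonal p q ℝ with hJdef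
  have hJ : J.IsSymm := Matrix.isSymm_diagonal _
  have hdet : J.det ≠ 0 := by
    rw [hJdef, indefiniteDiagonal, Matrix.det_diagonal]
    exact Finset.prod_ne_zero_iff.2 fun i _ ↦ by rcases i with i | i <;> simp
  have hcard : 3 ≤ Fintype.card (p ⊕ q) := by rwa [Fintype.card_sum]
  -- the hyperbolic pair `e = ε_a + ε_b`, `f = ½(ε_a - ε_b)`
  set e : p ⊕ q → ℝ := Pi.single (Sum.inl a) 1 + Pi.single (Sum.inr b) 1 with hedef
  set f : p ⊕ q → ℝ := (2 : ℝ)⁻¹ • (Pi.single (Sum.inl a) 1 - Pi.single (Sum.inr b) 1) with hfdef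
  have hJv : ∀ w : p ⊕ q → ℝ, J.mulVec w = fun i ↦ Sum.elim (fun _ ↦ (1 : ℝ)) (fun _ ↦ -1) i * w i := fun w ↦ by
    funext i; rw [hJdef, indefiniteDiagonal, Matrix.mulVec_diagonal]
  have he : Matrix.toLinearMap₂' ℝ J e e = 0 := by
    rw [Matrix.toLinearMap₂'_apply', hJv]
    simp [dotProduct, Fintype.sum_sum_type, hedef, Pi.single_apply]
  have hf : Matrix.toLinearMap₂' ℝ J f f = 0 := by
    rw [Matrix.toLinearMap₂'_apply', hJv]
    simp [dotProduct, Fintype.sum_sum_type, hfdef, Pi.single_apply]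
  have hef : Matrix.toLinearMap₂' ℝ J e f = 1 := by
    rw [Matrix.toLinearMap₂'_apply', hJv]
    simp [dotProduct, Fintype.sum_sum_type, hedef, hfdef, Pi.single_apply]
    norm_num
  obtain ⟨H, -, hH⟩ := exists_isJordanLefschetzPair_skewAdjointMatrices J hJ hdet hcard he hf hef
  exact ⟨H, hH⟩

/-- `𝔰𝔬(p, q)` (`p, q ≥ 1`, `p + q ≥ 3`) carries a Lefschetz pair structure. [cite: LooijengaLunts1997, §1 p. 7 L77–L78; §4 (4.5) p. 19 L23–L26] -/
theorem exists_isLefschetzPair_so' (p q : Type*) [Fintype p] [DecidableEq p] [Fintype q] [DecidableEq q]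
    [Nonempty p] [Nonempty q] (h3 : 3 ≤ Fintype.card p + Fintype.card q) :
    ∃ H : so' p q ℝ, IsLefschetzPair ℝ H := by
  obtain ⟨H, hH⟩ := exists_isJordanLefschetzPair_so' p q h3
  exact ⟨H, hH.isLefschetzPair⟩

end Literature.Algebra.Lie.HyperbolicPlaneGrading
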